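/-
Copyright (c) 2026. All rights reserved.
Released under Apache 2.0 license as described in the file LICENSE.
-/
import Literature.Geometry.Kaehler.ComplexTorusQuaternionXSixAtkinLehnerSpecialPointOrbits
import Literature.Geometry.Kaehler.ComplexTorusQuaternionXSixLOneClasses
import Literature.Geometry.Kaehler.ComplexTorusQuaternionXSixLThreeClasses
import Literature.Geometry.Kaehler.ComplexTorusQuaternionXSixLSixClasses
import HarnessLib

/-!
# `X₆⁺ = X₆/W` has exactly ONE point under each of `Z(1)`, `Z(3)`, `Z(6)`: `#(Pt(t)/Γ₆⁺) = 1` for `t = 1, 3, 6` — the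
# Atkin–Lehner group identifies the two order-`2` points, the two order-`3` points, and the two SCM points of `X₆`

[tag: complex_torus] [tag: abelian_surface] [tag: quaternion_multiplication] [tag: complex_multiplication]
[tag: shimura_curve] [tag: special_cycles] [tag: atkin_lehner] [tag: elliptic_points]

`Pt(t) = {τ ∈ ℌ : ρ(x)τ = τ, x ∈ 𝔬, tr x = 0, nr x = t}`, `Γ₆⁺ = {g ≠ 0 : gO₆ ⊆ O₆g, nr g > 0}` acting on `ℌ` through
`ρ` (`…XSixAtkinLehnerSpecialPointOrbits`, where `#(Pt(t)/Γ₆⁺) = |L(t)/N(O₆)|` is proved for `t ≡ 19 (mod 24)`, the free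
case). At `t = 1, 3, 6` the group `W` is NOT free on points (`ω₂` fixes the `Z(1)`-points, `ω₃` the `Z(3)`-points, `ω₆` the
`Z(6)`-points, `…XSixSpecialPointsDictionary`), and `X₆` carries two points each (`card_specialPoints_table`: `2, 2, 2`);
this file shows that `Γ₆⁺` merges each pair:

* `card_specialPointsPlus_one`, `_three`, `_six` (§2): **`#(Pt(t)/Γ₆⁺) = 1` for `t = 1, 3, 6`**, from the
  classifications `exists_normOne_conj_of_norm_one/three/six` and explicit positive-norm normaliser elements carrying
  every special vector of norm `t` to `±` the reference vector (`i`; `3i + j + ij`; `3i + j`): for `t = 1` the element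
  `(3 + 3i − j − ij)/2 = v·μ` (`v ∈ Γ₆`) conjugates `E = −2i + ij` to `−i`; for `t = 3, 6` the elements `w₂ = 1 + i`,
  `w̄₂ = 1 − i` and `i` suffice.
* `card_specialPointsPlus_table` (§2): the values `1, 1, 1, 1` for `t = 1, 3, 6, 19`.

Mechanism (§1, `card_specialPointsPlus_eq_one_of`): if every `x̂ ∈ L(t)` admits `g ∈ Γ₆⁺` and `s ≠ 0` with
`g x̂ ḡ = s·ĉ₀`, then any two points `p, q ∈ Pt(t)` are `Γ₆⁺`-equivalent — `ρ(g_p)p` and `ρ(g_q)q` are both the unique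
fixed point of `ρ(ĉ₀)` in `ℌ`, so `ḡ_q g_p ∈ Γ₆⁺` carries `p` to `q`.

## The print

* P. Bayer, A. Travesa (2007), §1 Thm. 1.1 and §2 (the points `P₀, …, P₈`; `Γ₆⁺/Γ₆ ≅ (ℤ/2ℤ)²`; the quotient by the
  Atkin–Lehner involutions). [cite: BayerTravesa2007, §1–§2]
* A. P. Ogg (1983), §2 p. 284 (fixed points of `w(m)`). [cite: Ogg1983RealPoints, §2]
* S. Kudla, M. Rapoport, T. Yang (2006), §3.4 Remark 3.4.7 and (3.4.11). [cite: KudlaRapoportYang2006, §3.4 Remark 3.4.7]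

## Scope (honest)

Theorems only — no definitions, no named facts, no instances; the relations are the inline ones of
`…XSixAtkinLehnerSpecialPointOrbits` and `…XSixSpecialCyclesPointCount`.
-/

noncomputable section

set_option maxSynthPendingDepth 3

open Quaternion Function

namespace Literature.Geometry.Kaehler.ComplexTorus.QuaternionType

/-! ## §0 Helpers -/

section Helpers

/-- The product of two non-zero quaternions of `(−1,3)_ℚ` is non-zero. [folklore] -/
private theorem mul_ne_zero₅ {g h : ℍ[ℚ,((-1 : ℤ) : ℚ),((3 : ℤ) : ℚ)]} (hg : g ≠ 0) (hh : h ≠ 0) : g * h ≠ 0 := by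
  intro h0
  have e := re_mul_mul_star_mul g h
  rw [h0, zero_mul, QuaternionAlgebra.re_zero] at e
  exact mul_ne_zero (norm_ne_zero_of_ne_zero hg) (norm_ne_zero_of_ne_zero hh) e.symm

/-- Composition of left-normalising elements. [folklore] -/
private theorem normalisesLeft_mul₅ {g h : ℍ[ℚ,((-1 : ℤ) : ℚ),((3 : ℤ) : ℚ)]}
    (hg : (∀ a : ℍ[ℚ,((-1 : ℤ) : ℚ),((3 : ℤ) : ℚ)], (a ∈ order (-1) 3 ∨ a - ⟨1/2, 1/2, 1/2, -1/2⟩ ∈ order (-1) 3) →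
      ∃ b : ℍ[ℚ,((-1 : ℤ) : ℚ),((3 : ℤ) : ℚ)], (b ∈ order (-1) 3 ∨ b - ⟨1/2, 1/2, 1/2, -1/2⟩ ∈ order (-1) 3) ∧ g * a = b * g))
    (hh : (∀ a : ℍ[ℚ,((-1 : ℤ) : ℚ),((3 : ℤ) : ℚ)], (a ∈ order (-1) 3 ∨ a - ⟨1/2, 1/2, 1/2, -1/2⟩ ∈ order (-1) 3) →
      ∃ b : ℍ[ℚ,((-1 : ℤ) : ℚ),((3 : ℤ) : ℚ)], (b ∈ order (-1) 3 ∨ b - ⟨1/2, 1/2, 1/2, -1/2⟩ ∈ order (-1) 3) ∧ h * a = b * h)) :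
    (∀ a : ℍ[ℚ,((-1 : ℤ) : ℚ),((3 : ℤ) : ℚ)], (a ∈ order (-1) 3 ∨ a - ⟨1/2, 1/2, 1/2, -1/2⟩ ∈ order (-1) 3) →
      ∃ b : ℍ[ℚ,((-1 : ℤ) : ℚ),((3 : ℤ) : ℚ)], (b ∈ order (-1) 3 ∨ b - ⟨1/2, 1/2, 1/2, -1/2⟩ ∈ order (-1) 3) ∧ h * g * a = b * (h * g)) := by
  intro a ha
  obtain ⟨b, hb, eb⟩ := hg a ha
  obtain ⟨c, hc, ec⟩ := hh b hb
  exact ⟨c, hc, by rw [mul_assoc, eb, ← mul_assoc, ec, mul_assoc]⟩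

/-- `gO₆ ⊆ O₆g ⟹ ḡO₆ ⊆ O₆ḡ`. [folklore] -/
private theorem normalises_star_of_left₅ {g : ℍ[ℚ,((-1 : ℤ) : ℚ),((3 : ℤ) : ℚ)]} (hg0 : g ≠ 0)
    (hL : (∀ a : ℍ[ℚ,((-1 : ℤ) : ℚ),((3 : ℤ) : ℚ)], (a ∈ order (-1) 3 ∨ a - ⟨1/2, 1/2, 1/2, -1/2⟩ ∈ order (-1) 3) →
      ∃ b : ℍ[ℚ,((-1 : ℤ) : ℚ),((3 : ℤ) : ℚ)], (b ∈ order (-1) 3 ∨ b - ⟨1/2, 1/2, 1/2, -1/2⟩ ∈ order (-1) 3) ∧ g * a = b * g)) :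
    ∀ a : ℍ[ℚ,((-1 : ℤ) : ℚ),((3 : ℤ) : ℚ)], (a ∈ order (-1) 3 ∨ a - ⟨1/2, 1/2, 1/2, -1/2⟩ ∈ order (-1) 3) →
      ∃ b : ℍ[ℚ,((-1 : ℤ) : ℚ),((3 : ℤ) : ℚ)], (b ∈ order (-1) 3 ∨ b - ⟨1/2, 1/2, 1/2, -1/2⟩ ∈ order (-1) 3) ∧
        star g * a = b * star g := by
  obtain ⟨q, v, k, l, -, hv, h1, -, -, hg⟩ := (normalises_maxOrder_iff_exists' hg0).1 hL
  have hR := (normalises_of_eq_smul_unit_mul_atkinLehner hv h1 k l hg).2.2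
  intro a ha
  obtain ⟨c, hc, e⟩ := hR (star a) (star_maxOrder ha)
  refine ⟨star c, star_maxOrder hc, ?_⟩
  have e' := congrArg star e
  rwa [star_mul, star_star, star_mul] at e'

/-- A `Γ₆`-element (`u ∈ O₆`, `nr u = 1`) is left-normalising and non-zero. [folklore] -/
private theorem normalisesLeft_of_normOne₅ {u : ℍ[ℚ,((-1 : ℤ) : ℚ),((3 : ℤ) : ℚ)]}
    (hu : u ∈ order (-1) 3 ∨ u - ⟨1/2, 1/2, 1/2, -1/2⟩ ∈ order (-1) 3) (hn : (u * star u).re = 1) :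
    u ≠ 0 ∧ (∀ a : ℍ[ℚ,((-1 : ℤ) : ℚ),((3 : ℤ) : ℚ)], (a ∈ order (-1) 3 ∨ a - ⟨1/2, 1/2, 1/2, -1/2⟩ ∈ order (-1) 3) →
      ∃ b : ℍ[ℚ,((-1 : ℤ) : ℚ),((3 : ℤ) : ℚ)], (b ∈ order (-1) 3 ∨ b - ⟨1/2, 1/2, 1/2, -1/2⟩ ∈ order (-1) 3) ∧ u * a = b * u) :=
  ⟨fun h0 ↦ by rw [h0, zero_mul, QuaternionAlgebra.re_zero] at hn; exact zero_ne_one hn,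
    (normalises_of_eq_smul_unit_mul_atkinLehner (g := u) (q := 1) hu (Or.inl (mul_star_eq_one_of_re hn)) 0 0
      (by rw [pow_zero, pow_zero, mul_one, mul_one, one_smul])).2.1⟩

/-- An explicit `v·w₂^k·μ^l` (`v ∈ O₆^{±1}`) is left-normalising. [folklore] -/
private theorem normalisesLeft_of_factor₅ {g v : ℍ[ℚ,((-1 : ℤ) : ℚ),((3 : ℤ) : ℚ)]}
    (hv : v ∈ order (-1) 3 ∨ v - ⟨1/2, 1/2, 1/2, -1/2⟩ ∈ order (-1) 3) (h1 : v * star v = 1 ∨ v * star v = -1)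
    (k l : ℕ) (hg : g = (1 : ℚ) • (v * ⟨1, 1, 0, 0⟩ ^ k * ⟨3, 0, 1, 1⟩ ^ l)) :
    (∀ a : ℍ[ℚ,((-1 : ℤ) : ℚ),((3 : ℤ) : ℚ)], (a ∈ order (-1) 3 ∨ a - ⟨1/2, 1/2, 1/2, -1/2⟩ ∈ order (-1) 3) →
      ∃ b : ℍ[ℚ,((-1 : ℤ) : ℚ),((3 : ℤ) : ℚ)], (b ∈ order (-1) 3 ∨ b - ⟨1/2, 1/2, 1/2, -1/2⟩ ∈ order (-1) 3) ∧ g * a = b * g) :=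
  (normalises_of_eq_smul_unit_mul_atkinLehner hv h1 k l hg).2.1

/-- `ρ(wv) = ρ(w) ∘ ρ(v)` on `ℌ` for positive norms. [folklore] -/
private theorem moebius_rho_castQ_mul₅ {v w : ℍ[ℚ,((-1 : ℤ) : ℚ),((3 : ℤ) : ℚ)]} (hv : 0 < (v * star v).re)
    (hw : 0 < (w * star w).re) {τ : ℂ} (hτ : 0 < τ.im) :
    moebius (rho (-1) 3 (by norm_num) (castQ (-1) 3 (w * v))) τ =
      moebius (rho (-1) 3 (by norm_num) (castQ (-1) 3 w)) (moebius (rho (-1) 3 (by norm_num) (castQ (-1) 3 v)) τ) := by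
  rw [castQ_mul, map_mul]
  exact moebius_mul_of_det_pos (det_rho_castQ_pos _ hw) (det_rho_castQ_pos _ hv) (UpperHalfPlane.mk τ hτ)

end Helpers

/-! ## §1 The engine: one reference vector reached from every special vector ⟹ one `Γ₆⁺`-class of points -/

section Engine

/-- **ONE `Γ₆⁺`-CLASS OF POINTS**: if `L(t) ≠ ∅` (`t > 0`) and every `x̂ ∈ L(t)` admits `g ∈ Γ₆⁺` and `s ≠ 0` with
`g x̂ ḡ = s·ĉ₀` for a fixed special `ĉ₀` of norm `t`, then `#(Pt(t)/Γ₆⁺) = 1`: `ρ(g_p)p = ρ(g_q)q` is the unique fixed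
point of `ρ(ĉ₀)`, and `ḡ_q g_p ∈ Γ₆⁺`. [cite: KudlaRapoportYang2006, §3.4 (3.4.9)–(3.4.11)] [cite: BayerTravesa2007, §2] -/
theorem card_specialPointsPlus_eq_one_of {t : ℤ} (ht : 0 < t) (c₀ : {x : ℤ × ℤ × ℤ // x.1 ^ 2 - 3 * x.2.1 ^ 2 - 3 * x.2.2 ^ 2 = t})
    (hall : ∀ x : {x : ℤ × ℤ × ℤ // x.1 ^ 2 - 3 * x.2.1 ^ 2 - 3 * x.2.2 ^ 2 = t}, ∃ g : ℍ[ℚ,((-1 : ℤ) : ℚ),((3 : ℤ) : ℚ)], g ≠ 0 ∧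
      (∀ a : ℍ[ℚ,((-1 : ℤ) : ℚ),((3 : ℤ) : ℚ)], (a ∈ order (-1) 3 ∨ a - ⟨1/2, 1/2, 1/2, -1/2⟩ ∈ order (-1) 3) →
        ∃ b : ℍ[ℚ,((-1 : ℤ) : ℚ),((3 : ℤ) : ℚ)], (b ∈ order (-1) 3 ∨ b - ⟨1/2, 1/2, 1/2, -1/2⟩ ∈ order (-1) 3) ∧ g * a = b * g) ∧
      0 < (g * star g).re ∧ ∃ s : ℚ, s ≠ 0 ∧
        g * ⟨0, x.1.1, x.1.2.1, x.1.2.2⟩ * star g = s • (⟨0, c₀.1.1, c₀.1.2.1, c₀.1.2.2⟩ : ℍ[ℚ,((-1 : ℤ) : ℚ),((3 : ℤ) : ℚ)])) :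
    Nat.card (Quot (fun p q : {τ : ℂ // 0 < τ.im ∧ ∃ x : ℍ[ℚ,((-1 : ℤ) : ℚ),((3 : ℤ) : ℚ)],
        x ∈ order (-1) 3 ∧ x.re = 0 ∧ (x * star x).re = t ∧ moebius (rho (-1) 3 (by norm_num) (castQ (-1) 3 x)) τ = τ} ↦
      ∃ g : ℍ[ℚ,((-1 : ℤ) : ℚ),((3 : ℤ) : ℚ)], g ≠ 0 ∧
        (∀ a : ℍ[ℚ,((-1 : ℤ) : ℚ),((3 : ℤ) : ℚ)], (a ∈ order (-1) 3 ∨ a - ⟨1/2, 1/2, 1/2, -1/2⟩ ∈ order (-1) 3) →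
          ∃ b : ℍ[ℚ,((-1 : ℤ) : ℚ),((3 : ℤ) : ℚ)], (b ∈ order (-1) 3 ∨ b - ⟨1/2, 1/2, 1/2, -1/2⟩ ∈ order (-1) 3) ∧
            g * a = b * g) ∧
        0 < (g * star g).re ∧ moebius (rho (-1) 3 (by norm_num) (castQ (-1) 3 g)) p.1 = q.1)) = 1 := by
  set P : {τ : ℂ // 0 < τ.im ∧ ∃ x : ℍ[ℚ,((-1 : ℤ) : ℚ),((3 : ℤ) : ℚ)],
        x ∈ order (-1) 3 ∧ x.re = 0 ∧ (x * star x).re = t ∧ moebius (rho (-1) 3 (by norm_num) (castQ (-1) 3 x)) τ = τ} →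
      {τ : ℂ // 0 < τ.im ∧ ∃ x : ℍ[ℚ,((-1 : ℤ) : ℚ),((3 : ℤ) : ℚ)],
        x ∈ order (-1) 3 ∧ x.re = 0 ∧ (x * star x).re = t ∧ moebius (rho (-1) 3 (by norm_num) (castQ (-1) 3 x)) τ = τ} → Prop :=
    fun p q ↦ ∃ g : ℍ[ℚ,((-1 : ℤ) : ℚ),((3 : ℤ) : ℚ)], g ≠ 0 ∧
        (∀ a : ℍ[ℚ,((-1 : ℤ) : ℚ),((3 : ℤ) : ℚ)], (a ∈ order (-1) 3 ∨ a - ⟨1/2, 1/2, 1/2, -1/2⟩ ∈ order (-1) 3) →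
          ∃ b : ℍ[ℚ,((-1 : ℤ) : ℚ),((3 : ℤ) : ℚ)], (b ∈ order (-1) 3 ∨ b - ⟨1/2, 1/2, 1/2, -1/2⟩ ∈ order (-1) 3) ∧
            g * a = b * g) ∧
        0 < (g * star g).re ∧ moebius (rho (-1) 3 (by norm_num) (castQ (-1) 3 g)) p.1 = q.1 with hP
  have hEP : Equivalence P := specialPointsPlus_equivalence t
  have hiffP : ∀ p q, Quot.mk P p = Quot.mk P q ↔ P p q := specialPointsPlus_mk_eq_iff t
  have h3 : (0 : ℤ) < 3 := by norm_num
  have hnorm : ∀ x : {x : ℤ × ℤ × ℤ // x.1 ^ 2 - 3 * x.2.1 ^ 2 - 3 * x.2.2 ^ 2 = t},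
      ((⟨0, x.1.1, x.1.2.1, x.1.2.2⟩ : ℍ[ℚ,((-1 : ℤ) : ℚ),((3 : ℤ) : ℚ)]) * star ⟨0, x.1.1, x.1.2.1, x.1.2.2⟩).re = t := by
    intro x
    have hx : x.1.1 ^ 2 - 3 * x.1.2.1 ^ 2 - 3 * x.1.2.2 ^ 2 = t := x.2
    rw [pureVec_norm]; exact_mod_cast hx
  have hpos : ∀ x : {x : ℤ × ℤ × ℤ // x.1 ^ 2 - 3 * x.2.1 ^ 2 - 3 * x.2.2 ^ 2 = t},
      0 < ((⟨0, x.1.1, x.1.2.1, x.1.2.2⟩ : ℍ[ℚ,((-1 : ℤ) : ℚ),((3 : ℤ) : ℚ)]) * star ⟨0, x.1.1, x.1.2.1, x.1.2.2⟩).re := by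
    intro x; rw [hnorm x]; exact_mod_cast ht
  -- every point is carried by some `g ∈ Γ₆⁺` to a fixed point of `ρ(ĉ₀)`
  have key : ∀ p : {τ : ℂ // 0 < τ.im ∧ ∃ x : ℍ[ℚ,((-1 : ℤ) : ℚ),((3 : ℤ) : ℚ)],
        x ∈ order (-1) 3 ∧ x.re = 0 ∧ (x * star x).re = t ∧ moebius (rho (-1) 3 (by norm_num) (castQ (-1) 3 x)) τ = τ}, ∃ g : ℍ[ℚ,((-1 : ℤ) : ℚ),((3 : ℤ) : ℚ)], g ≠ 0 ∧
      (∀ a : ℍ[ℚ,((-1 : ℤ) : ℚ),((3 : ℤ) : ℚ)], (a ∈ order (-1) 3 ∨ a - ⟨1/2, 1/2, 1/2, -1/2⟩ ∈ order (-1) 3) →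
        ∃ b : ℍ[ℚ,((-1 : ℤ) : ℚ),((3 : ℤ) : ℚ)], (b ∈ order (-1) 3 ∨ b - ⟨1/2, 1/2, 1/2, -1/2⟩ ∈ order (-1) 3) ∧ g * a = b * g) ∧
      0 < (g * star g).re ∧
      moebius (rho (-1) 3 (by norm_num) (castQ (-1) 3 (⟨0, c₀.1.1, c₀.1.2.1, c₀.1.2.2⟩ : ℍ[ℚ,((-1 : ℤ) : ℚ),((3 : ℤ) : ℚ)])))
        (moebius (rho (-1) 3 (by norm_num) (castQ (-1) 3 g)) p.1) =
        moebius (rho (-1) 3 (by norm_num) (castQ (-1) 3 g)) p.1 := by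
    intro p
    obtain ⟨x, hx, hre, hxn, hfix⟩ := p.2.2
    obtain ⟨⟨p₁, p₂, p₃⟩, hpe, hpQ⟩ := exists_eq_mk_of_mem_order_re_zero hx hre
    dsimp only at hpe hpQ
    rw [hxn] at hpQ
    have hQ : p₁ ^ 2 - 3 * p₂ ^ 2 - 3 * p₃ ^ 2 = t := by exact_mod_cast hpQ
    obtain ⟨g, hg0, hL, hgn, s, hs, hconj⟩ := hall ⟨(p₁, p₂, p₃), hQ⟩
    refine ⟨g, hg0, hL, hgn, ?_⟩
    have hf := moebius_conj_fixed_of_im_ne_zero h3 (ε := g) (x := x) hgn.ne' p.2.1.ne' hfix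
    have hconj' : g * x * star g = s • (⟨0, c₀.1.1, c₀.1.2.1, c₀.1.2.2⟩ : ℍ[ℚ,((-1 : ℤ) : ℚ),((3 : ℤ) : ℚ)]) := by
      rw [hpe]; exact hconj
    rw [hconj', moebius_rho_castQ_smul hs] at hf
    exact hf
  -- hence any two points are `Γ₆⁺`-equivalent
  have hsub : ∀ p q : {τ : ℂ // 0 < τ.im ∧ ∃ x : ℍ[ℚ,((-1 : ℤ) : ℚ),((3 : ℤ) : ℚ)],
        x ∈ order (-1) 3 ∧ x.re = 0 ∧ (x * star x).re = t ∧ moebius (rho (-1) 3 (by norm_num) (castQ (-1) 3 x)) τ = τ}, P p q := by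
    intro p q
    obtain ⟨g, hg0, hgL, hgn, hgf⟩ := key p
    obtain ⟨h, hh0, hhL, hhn, hhf⟩ := key q
    have hgp : 0 < (moebius (rho (-1) 3 (by norm_num) (castQ (-1) 3 g)) p.1).im := im_moebius_rho_pos h3 hgn p.2.1
    have hhq : 0 < (moebius (rho (-1) 3 (by norm_num) (castQ (-1) 3 h)) q.1).im := im_moebius_rho_pos h3 hhn q.2.1
    have heq : moebius (rho (-1) 3 (by norm_num) (castQ (-1) 3 g)) p.1 =
        moebius (rho (-1) 3 (by norm_num) (castQ (-1) 3 h)) q.1 := by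
      have hu := fixedPoint_unique_of_trace_eq_zero (trace_rho_castQ_eq_zero _ rfl) (det_rho_castQ_pos _ (hpos c₀))
        (τ₁ := UpperHalfPlane.mk _ hgp) (τ₂ := UpperHalfPlane.mk _ hhq) hgf hhf
      exact congrArg UpperHalfPlane.coe hu
    refine ⟨star h * g, mul_ne_zero₅ (star_ne_zero.2 hh0) hg0, normalisesLeft_mul₅ hgL (normalises_star_of_left₅ hh0 hhL),
      by rw [re_mul_mul_star_mul, star_star, star_comm_self' h]; exact mul_pos hhn hgn, ?_⟩
    rw [moebius_rho_castQ_mul₅ hgn (by rw [star_star, star_comm_self' h]; exact hhn) p.2.1, heq]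
    exact moebius_rho_star_moebius_rho h3 hhn (UpperHalfPlane.mk q.1 q.2.1)
  -- and `Pt(t)` is non-empty: the fixed point of `ρ(ĉ₀)`
  obtain ⟨τ, hτ⟩ := (existsUnique_fixedPoint_of_special (by norm_num)
    (x := (⟨0, c₀.1.1, c₀.1.2.1, c₀.1.2.2⟩ : ℍ[ℚ,((-1 : ℤ) : ℚ),((3 : ℤ) : ℚ)])) rfl (hpos c₀)).exists
  have hmem : (⟨0, c₀.1.1, c₀.1.2.1, c₀.1.2.2⟩ : ℍ[ℚ,((-1 : ℤ) : ℚ),((3 : ℤ) : ℚ)]) ∈ order (-1) 3 :=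
    ⟨![0, c₀.1.1, c₀.1.2.1, c₀.1.2.2], by ext <;> simp [ofCoords]⟩
  rw [Nat.card_eq_one_iff_unique]
  refine ⟨⟨fun a b ↦ ?_⟩, ⟨Quot.mk P ⟨(τ : ℂ), τ.2, ⟨0, c₀.1.1, c₀.1.2.1, c₀.1.2.2⟩, hmem, rfl, hnorm c₀, hτ⟩⟩⟩
  induction a using Quot.ind with
  | _ p =>
    induction b using Quot.ind with
    | _ q => exact (hiffP p q).2 (hsub p q)

end Engine

/-! ## §2 `t = 1, 3, 6` -/

section Small

/-- **`#(Pt(1)/Γ₆⁺) = 1`: the two elliptic points of order `2` of `X₆` (`Z(1)`: `P₆`, `P₁₃₅`) become ONE point of `X₆⁺`** —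
`(3 + 3i − j − ij)/2 ∈ Γ₆μ` (norm `3`) conjugates `E = −2i + ij` to `−3i`. [cite: BayerTravesa2007, §1 Thm. 1.1 and §2] [cite: Ogg1983RealPoints, §2 p. 284] -/
theorem card_specialPointsPlus_one :
    Nat.card (Quot (fun p q : {τ : ℂ // 0 < τ.im ∧ ∃ x : ℍ[ℚ,((-1 : ℤ) : ℚ),((3 : ℤ) : ℚ)],
        x ∈ order (-1) 3 ∧ x.re = 0 ∧ (x * star x).re = ((1 : ℤ) : ℚ) ∧ moebius (rho (-1) 3 (by norm_num) (castQ (-1) 3 x)) τ = τ} ↦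
      ∃ g : ℍ[ℚ,((-1 : ℤ) : ℚ),((3 : ℤ) : ℚ)], g ≠ 0 ∧
        (∀ a : ℍ[ℚ,((-1 : ℤ) : ℚ),((3 : ℤ) : ℚ)], (a ∈ order (-1) 3 ∨ a - ⟨1/2, 1/2, 1/2, -1/2⟩ ∈ order (-1) 3) →
          ∃ b : ℍ[ℚ,((-1 : ℤ) : ℚ),((3 : ℤ) : ℚ)], (b ∈ order (-1) 3 ∨ b - ⟨1/2, 1/2, 1/2, -1/2⟩ ∈ order (-1) 3) ∧
            g * a = b * g) ∧
        0 < (g * star g).re ∧ moebius (rho (-1) 3 (by norm_num) (castQ (-1) 3 g)) p.1 = q.1)) = 1 := by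
  refine card_specialPointsPlus_eq_one_of (t := 1) (by norm_num) ⟨(1, 0, 0), by norm_num⟩ fun x ↦ ?_
  obtain ⟨u, hu, hn, hh⟩ := exists_normOne_conj_of_norm_one x.1 x.2
  obtain ⟨hu0, hLu⟩ := normalisesLeft_of_normOne₅ hu hn
  have hu1 : u * star u = 1 := mul_star_eq_one_of_re hn
  have hconj : ∀ c : ℍ[ℚ,((-1 : ℤ) : ℚ),((3 : ℤ) : ℚ)], u * ⟨0, x.1.1, x.1.2.1, x.1.2.2⟩ = c * u → u * ⟨0, x.1.1, x.1.2.1, x.1.2.2⟩ * star u = c :=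
    fun c h ↦ by rw [h, mul_assoc, hu1, mul_one]
  show ∃ g : ℍ[ℚ,((-1 : ℤ) : ℚ),((3 : ℤ) : ℚ)], g ≠ 0 ∧ _ ∧ 0 < (g * star g).re ∧ ∃ s : ℚ, s ≠ 0 ∧
      g * ⟨0, x.1.1, x.1.2.1, x.1.2.2⟩ * star g = s • (⟨0, ((1 : ℤ) : ℚ), ((0 : ℤ) : ℚ), ((0 : ℤ) : ℚ)⟩ : ℍ[ℚ,((-1 : ℤ) : ℚ),((3 : ℤ) : ℚ)])
  rw [show (⟨0, ((1 : ℤ) : ℚ), ((0 : ℤ) : ℚ), ((0 : ℤ) : ℚ)⟩ : ℍ[ℚ,((-1 : ℤ) : ℚ),((3 : ℤ) : ℚ)]) = ⟨0, 1, 0, 0⟩ by ext <;> norm_num]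
  rcases hh with h | h | h | h
  · exact ⟨u, hu0, hLu, by rw [hn]; exact one_pos, 1, one_ne_zero, by rw [hconj _ h, one_smul]⟩
  · -- (-1, 0, 0) → -1·c₀ via g = ⟨1, 0, 0, 0⟩ (nr 1) = v·w₂^0·μ^0, v = ⟨1, 0, 0, 0⟩
    have hz : (⟨1, 0, 0, 0⟩ : ℍ[ℚ,((-1 : ℤ) : ℚ),((3 : ℤ) : ℚ)]) ≠ 0 := fun h0 ↦ by
      have := congrArg QuaternionAlgebra.re h0; norm_num at this
    have hLg := normalisesLeft_of_factor₅ (g := (⟨1, 0, 0, 0⟩ : ℍ[ℚ,((-1 : ℤ) : ℚ),((3 : ℤ) : ℚ)])) (v := ⟨1, 0, 0, 0⟩)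
      (Or.inl ⟨![1, 0, 0, 0], by ext <;> simp [ofCoords]⟩)
      (Or.inl (by rw [QuaternionAlgebra.star_mk, QuaternionAlgebra.mk_mul_mk]; ext <;> norm_num)) 0 0
      (by rw [one_smul, pow_zero, pow_zero, mul_one, mul_one])
    have hng : ((⟨1, 0, 0, 0⟩ : ℍ[ℚ,((-1 : ℤ) : ℚ),((3 : ℤ) : ℚ)]) * star ⟨1, 0, 0, 0⟩).re = 1 := by
      rw [QuaternionAlgebra.star_mk, QuaternionAlgebra.mk_mul_mk]; norm_num
    have m : (⟨1, 0, 0, 0⟩ : ℍ[ℚ,((-1 : ℤ) : ℚ),((3 : ℤ) : ℚ)]) * ⟨0, -1, 0, 0⟩ * star ⟨1, 0, 0, 0⟩ = (-1 : ℚ) • (⟨0, 1, 0, 0⟩ : ℍ[ℚ,((-1 : ℤ) : ℚ),((3 : ℤ) : ℚ)]) := by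
      rw [QuaternionAlgebra.star_mk, QuaternionAlgebra.mk_mul_mk, QuaternionAlgebra.mk_mul_mk, QuaternionAlgebra.smul_mk]
      ext <;> norm_num
    refine ⟨⟨1, 0, 0, 0⟩ * u, mul_ne_zero₅ hz hu0, normalisesLeft_mul₅ hLu hLg,
      by rw [re_mul_mul_star_mul, hng, hn]; norm_num, -1, by norm_num, ?_⟩
    rw [star_mul, show (⟨1, 0, 0, 0⟩ : ℍ[ℚ,((-1 : ℤ) : ℚ),((3 : ℤ) : ℚ)]) * u * ⟨0, x.1.1, x.1.2.1, x.1.2.2⟩ * (star u * star ⟨1, 0, 0, 0⟩) =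
        ⟨1, 0, 0, 0⟩ * (u * ⟨0, x.1.1, x.1.2.1, x.1.2.2⟩ * star u) * star ⟨1, 0, 0, 0⟩ by simp only [mul_assoc], hconj _ h, m]
  · -- (-2, 0, 1) → -1·c₀ via g = ⟨3/2, 3/2, -1/2, -1/2⟩ (nr 3) = v·w₂^0·μ^1, v = ⟨5/2, 3/2, -1/2, -3/2⟩
    have hz : (⟨3/2, 3/2, -1/2, -1/2⟩ : ℍ[ℚ,((-1 : ℤ) : ℚ),((3 : ℤ) : ℚ)]) ≠ 0 := fun h0 ↦ by
      have := congrArg QuaternionAlgebra.re h0; norm_num at this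
    have hLg := normalisesLeft_of_factor₅ (g := (⟨3/2, 3/2, -1/2, -1/2⟩ : ℍ[ℚ,((-1 : ℤ) : ℚ),((3 : ℤ) : ℚ)])) (v := ⟨5/2, 3/2, -1/2, -3/2⟩)
      (Or.inr ⟨![2, 1, -1, -1], by rw [QuaternionAlgebra.mk_sub_mk]; ext <;> norm_num [ofCoords, Matrix.cons_val_three,
        Matrix.cons_val_two, Matrix.cons_val_one, Matrix.cons_val_zero, Matrix.tail_cons, Matrix.head_cons]⟩)
      (Or.inl (by rw [QuaternionAlgebra.star_mk, QuaternionAlgebra.mk_mul_mk]; ext <;> norm_num)) 0 1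
      (by rw [one_smul, pow_zero, pow_one, mul_one, QuaternionAlgebra.mk_mul_mk]; ext <;> norm_num)
    have hng : ((⟨3/2, 3/2, -1/2, -1/2⟩ : ℍ[ℚ,((-1 : ℤ) : ℚ),((3 : ℤ) : ℚ)]) * star ⟨3/2, 3/2, -1/2, -1/2⟩).re = 3 := by
      rw [QuaternionAlgebra.star_mk, QuaternionAlgebra.mk_mul_mk]; norm_num
    have m : (⟨3/2, 3/2, -1/2, -1/2⟩ : ℍ[ℚ,((-1 : ℤ) : ℚ),((3 : ℤ) : ℚ)]) * ⟨0, -2, 0, 1⟩ * star ⟨3/2, 3/2, -1/2, -1/2⟩ = (-3 : ℚ) • (⟨0, 1, 0, 0⟩ : ℍ[ℚ,((-1 : ℤ) : ℚ),((3 : ℤ) : ℚ)]) := by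
      rw [QuaternionAlgebra.star_mk, QuaternionAlgebra.mk_mul_mk, QuaternionAlgebra.mk_mul_mk, QuaternionAlgebra.smul_mk]
      ext <;> norm_num
    refine ⟨⟨3/2, 3/2, -1/2, -1/2⟩ * u, mul_ne_zero₅ hz hu0, normalisesLeft_mul₅ hLu hLg,
      by rw [re_mul_mul_star_mul, hng, hn]; norm_num, -3, by norm_num, ?_⟩
    rw [star_mul, show (⟨3/2, 3/2, -1/2, -1/2⟩ : ℍ[ℚ,((-1 : ℤ) : ℚ),((3 : ℤ) : ℚ)]) * u * ⟨0, x.1.1, x.1.2.1, x.1.2.2⟩ * (star u * star ⟨3/2, 3/2, -1/2, -1/2⟩) =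
        ⟨3/2, 3/2, -1/2, -1/2⟩ * (u * ⟨0, x.1.1, x.1.2.1, x.1.2.2⟩ * star u) * star ⟨3/2, 3/2, -1/2, -1/2⟩ by simp only [mul_assoc], hconj _ h, m]
  · -- (2, 0, -1) → 1·c₀ via g = ⟨3/2, 3/2, -1/2, -1/2⟩ (nr 3) = v·w₂^0·μ^1, v = ⟨5/2, 3/2, -1/2, -3/2⟩
    have hz : (⟨3/2, 3/2, -1/2, -1/2⟩ : ℍ[ℚ,((-1 : ℤ) : ℚ),((3 : ℤ) : ℚ)]) ≠ 0 := fun h0 ↦ by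
      have := congrArg QuaternionAlgebra.re h0; norm_num at this
    have hLg := normalisesLeft_of_factor₅ (g := (⟨3/2, 3/2, -1/2, -1/2⟩ : ℍ[ℚ,((-1 : ℤ) : ℚ),((3 : ℤ) : ℚ)])) (v := ⟨5/2, 3/2, -1/2, -3/2⟩)
      (Or.inr ⟨![2, 1, -1, -1], by rw [QuaternionAlgebra.mk_sub_mk]; ext <;> norm_num [ofCoords, Matrix.cons_val_three,
        Matrix.cons_val_two, Matrix.cons_val_one, Matrix.cons_val_zero, Matrix.tail_cons, Matrix.head_cons]⟩)
      (Or.inl (by rw [QuaternionAlgebra.star_mk, QuaternionAlgebra.mk_mul_mk]; ext <;> norm_num)) 0 1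
      (by rw [one_smul, pow_zero, pow_one, mul_one, QuaternionAlgebra.mk_mul_mk]; ext <;> norm_num)
    have hng : ((⟨3/2, 3/2, -1/2, -1/2⟩ : ℍ[ℚ,((-1 : ℤ) : ℚ),((3 : ℤ) : ℚ)]) * star ⟨3/2, 3/2, -1/2, -1/2⟩).re = 3 := by
      rw [QuaternionAlgebra.star_mk, QuaternionAlgebra.mk_mul_mk]; norm_num
    have m : (⟨3/2, 3/2, -1/2, -1/2⟩ : ℍ[ℚ,((-1 : ℤ) : ℚ),((3 : ℤ) : ℚ)]) * ⟨0, 2, 0, -1⟩ * star ⟨3/2, 3/2, -1/2, -1/2⟩ = (3 : ℚ) • (⟨0, 1, 0, 0⟩ : ℍ[ℚ,((-1 : ℤ) : ℚ),((3 : ℤ) : ℚ)]) := by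
      rw [QuaternionAlgebra.star_mk, QuaternionAlgebra.mk_mul_mk, QuaternionAlgebra.mk_mul_mk, QuaternionAlgebra.smul_mk]
      ext <;> norm_num
    refine ⟨⟨3/2, 3/2, -1/2, -1/2⟩ * u, mul_ne_zero₅ hz hu0, normalisesLeft_mul₅ hLu hLg,
      by rw [re_mul_mul_star_mul, hng, hn]; norm_num, 3, by norm_num, ?_⟩
    rw [star_mul, show (⟨3/2, 3/2, -1/2, -1/2⟩ : ℍ[ℚ,((-1 : ℤ) : ℚ),((3 : ℤ) : ℚ)]) * u * ⟨0, x.1.1, x.1.2.1, x.1.2.2⟩ * (star u * star ⟨3/2, 3/2, -1/2, -1/2⟩) =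
        ⟨3/2, 3/2, -1/2, -1/2⟩ * (u * ⟨0, x.1.1, x.1.2.1, x.1.2.2⟩ * star u) * star ⟨3/2, 3/2, -1/2, -1/2⟩ by simp only [mul_assoc], hconj _ h, m]

/-- **`#(Pt(3)/Γ₆⁺) = 1`: the two elliptic points of order `3` of `X₆` (`Z(3)`: `P₂`, `P₄`) become ONE point of `X₆⁺`**
(`w₂`, `w̄₂ = 1 − i` and `i` carry `±3i + j ± ij` to `±(3i + j + ij)`). [cite: BayerTravesa2007, §1 Thm. 1.1 and §2] [cite: Ogg1983RealPoints, §2 p. 284] -/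
theorem card_specialPointsPlus_three :
    Nat.card (Quot (fun p q : {τ : ℂ // 0 < τ.im ∧ ∃ x : ℍ[ℚ,((-1 : ℤ) : ℚ),((3 : ℤ) : ℚ)],
        x ∈ order (-1) 3 ∧ x.re = 0 ∧ (x * star x).re = ((3 : ℤ) : ℚ) ∧ moebius (rho (-1) 3 (by norm_num) (castQ (-1) 3 x)) τ = τ} ↦
      ∃ g : ℍ[ℚ,((-1 : ℤ) : ℚ),((3 : ℤ) : ℚ)], g ≠ 0 ∧
        (∀ a : ℍ[ℚ,((-1 : ℤ) : ℚ),((3 : ℤ) : ℚ)], (a ∈ order (-1) 3 ∨ a - ⟨1/2, 1/2, 1/2, -1/2⟩ ∈ order (-1) 3) →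
          ∃ b : ℍ[ℚ,((-1 : ℤ) : ℚ),((3 : ℤ) : ℚ)], (b ∈ order (-1) 3 ∨ b - ⟨1/2, 1/2, 1/2, -1/2⟩ ∈ order (-1) 3) ∧
            g * a = b * g) ∧
        0 < (g * star g).re ∧ moebius (rho (-1) 3 (by norm_num) (castQ (-1) 3 g)) p.1 = q.1)) = 1 := by
  refine card_specialPointsPlus_eq_one_of (t := 3) (by norm_num) ⟨(3, 1, 1), by norm_num⟩ fun x ↦ ?_
  obtain ⟨u, hu, hn, hh⟩ := exists_normOne_conj_of_norm_three x.1 x.2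
  obtain ⟨hu0, hLu⟩ := normalisesLeft_of_normOne₅ hu hn
  have hu1 : u * star u = 1 := mul_star_eq_one_of_re hn
  have hconj : ∀ c : ℍ[ℚ,((-1 : ℤ) : ℚ),((3 : ℤ) : ℚ)], u * ⟨0, x.1.1, x.1.2.1, x.1.2.2⟩ = c * u → u * ⟨0, x.1.1, x.1.2.1, x.1.2.2⟩ * star u = c :=
    fun c h ↦ by rw [h, mul_assoc, hu1, mul_one]
  show ∃ g : ℍ[ℚ,((-1 : ℤ) : ℚ),((3 : ℤ) : ℚ)], g ≠ 0 ∧ _ ∧ 0 < (g * star g).re ∧ ∃ s : ℚ, s ≠ 0 ∧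
      g * ⟨0, x.1.1, x.1.2.1, x.1.2.2⟩ * star g = s • (⟨0, ((3 : ℤ) : ℚ), ((1 : ℤ) : ℚ), ((1 : ℤ) : ℚ)⟩ : ℍ[ℚ,((-1 : ℤ) : ℚ),((3 : ℤ) : ℚ)])
  rw [show (⟨0, ((3 : ℤ) : ℚ), ((1 : ℤ) : ℚ), ((1 : ℤ) : ℚ)⟩ : ℍ[ℚ,((-1 : ℤ) : ℚ),((3 : ℤ) : ℚ)]) = ⟨0, 3, 1, 1⟩ by ext <;> norm_num]
  rcases hh with h | h | h | h
  · exact ⟨u, hu0, hLu, by rw [hn]; exact one_pos, 1, one_ne_zero, by rw [hconj _ h, one_smul]⟩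
  · -- (3, 1, -1) → 1·c₀ via g = ⟨1, 1, 0, 0⟩ (nr 2) = v·w₂^1·μ^0, v = ⟨1, 0, 0, 0⟩
    have hz : (⟨1, 1, 0, 0⟩ : ℍ[ℚ,((-1 : ℤ) : ℚ),((3 : ℤ) : ℚ)]) ≠ 0 := fun h0 ↦ by
      have := congrArg QuaternionAlgebra.re h0; norm_num at this
    have hLg := normalisesLeft_of_factor₅ (g := (⟨1, 1, 0, 0⟩ : ℍ[ℚ,((-1 : ℤ) : ℚ),((3 : ℤ) : ℚ)])) (v := ⟨1, 0, 0, 0⟩)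
      (Or.inl ⟨![1, 0, 0, 0], by ext <;> simp [ofCoords]⟩)
      (Or.inl (by rw [QuaternionAlgebra.star_mk, QuaternionAlgebra.mk_mul_mk]; ext <;> norm_num)) 1 0
      (by rw [one_smul, pow_one, pow_zero, mul_one, QuaternionAlgebra.mk_mul_mk]; ext <;> norm_num)
    have hng : ((⟨1, 1, 0, 0⟩ : ℍ[ℚ,((-1 : ℤ) : ℚ),((3 : ℤ) : ℚ)]) * star ⟨1, 1, 0, 0⟩).re = 2 := by
      rw [QuaternionAlgebra.star_mk, QuaternionAlgebra.mk_mul_mk]; norm_num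
    have m : (⟨1, 1, 0, 0⟩ : ℍ[ℚ,((-1 : ℤ) : ℚ),((3 : ℤ) : ℚ)]) * ⟨0, 3, 1, -1⟩ * star ⟨1, 1, 0, 0⟩ = (2 : ℚ) • (⟨0, 3, 1, 1⟩ : ℍ[ℚ,((-1 : ℤ) : ℚ),((3 : ℤ) : ℚ)]) := by
      rw [QuaternionAlgebra.star_mk, QuaternionAlgebra.mk_mul_mk, QuaternionAlgebra.mk_mul_mk, QuaternionAlgebra.smul_mk]
      ext <;> norm_num
    refine ⟨⟨1, 1, 0, 0⟩ * u, mul_ne_zero₅ hz hu0, normalisesLeft_mul₅ hLu hLg,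
      by rw [re_mul_mul_star_mul, hng, hn]; norm_num, 2, by norm_num, ?_⟩
    rw [star_mul, show (⟨1, 1, 0, 0⟩ : ℍ[ℚ,((-1 : ℤ) : ℚ),((3 : ℤ) : ℚ)]) * u * ⟨0, x.1.1, x.1.2.1, x.1.2.2⟩ * (star u * star ⟨1, 1, 0, 0⟩) =
        ⟨1, 1, 0, 0⟩ * (u * ⟨0, x.1.1, x.1.2.1, x.1.2.2⟩ * star u) * star ⟨1, 1, 0, 0⟩ by simp only [mul_assoc], hconj _ h, m]
  · -- (-3, 1, 1) → -1·c₀ via g = ⟨0, 1, 0, 0⟩ (nr 1) = v·w₂^0·μ^0, v = ⟨0, 1, 0, 0⟩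
    have hz : (⟨0, 1, 0, 0⟩ : ℍ[ℚ,((-1 : ℤ) : ℚ),((3 : ℤ) : ℚ)]) ≠ 0 := fun h0 ↦ by
      have := congrArg QuaternionAlgebra.imI h0; norm_num at this
    have hLg := normalisesLeft_of_factor₅ (g := (⟨0, 1, 0, 0⟩ : ℍ[ℚ,((-1 : ℤ) : ℚ),((3 : ℤ) : ℚ)])) (v := ⟨0, 1, 0, 0⟩)
      (Or.inl ⟨![0, 1, 0, 0], by ext <;> simp [ofCoords]⟩)
      (Or.inl (by rw [QuaternionAlgebra.star_mk, QuaternionAlgebra.mk_mul_mk]; ext <;> norm_num)) 0 0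
      (by rw [one_smul, pow_zero, pow_zero, mul_one, mul_one])
    have hng : ((⟨0, 1, 0, 0⟩ : ℍ[ℚ,((-1 : ℤ) : ℚ),((3 : ℤ) : ℚ)]) * star ⟨0, 1, 0, 0⟩).re = 1 := by
      rw [QuaternionAlgebra.star_mk, QuaternionAlgebra.mk_mul_mk]; norm_num
    have m : (⟨0, 1, 0, 0⟩ : ℍ[ℚ,((-1 : ℤ) : ℚ),((3 : ℤ) : ℚ)]) * ⟨0, -3, 1, 1⟩ * star ⟨0, 1, 0, 0⟩ = (-1 : ℚ) • (⟨0, 3, 1, 1⟩ : ℍ[ℚ,((-1 : ℤ) : ℚ),((3 : ℤ) : ℚ)]) := by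
      rw [QuaternionAlgebra.star_mk, QuaternionAlgebra.mk_mul_mk, QuaternionAlgebra.mk_mul_mk, QuaternionAlgebra.smul_mk]
      ext <;> norm_num
    refine ⟨⟨0, 1, 0, 0⟩ * u, mul_ne_zero₅ hz hu0, normalisesLeft_mul₅ hLu hLg,
      by rw [re_mul_mul_star_mul, hng, hn]; norm_num, -1, by norm_num, ?_⟩
    rw [star_mul, show (⟨0, 1, 0, 0⟩ : ℍ[ℚ,((-1 : ℤ) : ℚ),((3 : ℤ) : ℚ)]) * u * ⟨0, x.1.1, x.1.2.1, x.1.2.2⟩ * (star u * star ⟨0, 1, 0, 0⟩) =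
        ⟨0, 1, 0, 0⟩ * (u * ⟨0, x.1.1, x.1.2.1, x.1.2.2⟩ * star u) * star ⟨0, 1, 0, 0⟩ by simp only [mul_assoc], hconj _ h, m]
  · -- (-3, 1, -1) → -1·c₀ via g = ⟨1, -1, 0, 0⟩ (nr 2) = v·w₂^1·μ^0, v = ⟨0, -1, 0, 0⟩
    have hz : (⟨1, -1, 0, 0⟩ : ℍ[ℚ,((-1 : ℤ) : ℚ),((3 : ℤ) : ℚ)]) ≠ 0 := fun h0 ↦ by
      have := congrArg QuaternionAlgebra.re h0; norm_num at this
    have hLg := normalisesLeft_of_factor₅ (g := (⟨1, -1, 0, 0⟩ : ℍ[ℚ,((-1 : ℤ) : ℚ),((3 : ℤ) : ℚ)])) (v := ⟨0, -1, 0, 0⟩)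
      (Or.inl ⟨![0, -1, 0, 0], by ext <;> simp [ofCoords]⟩)
      (Or.inl (by rw [QuaternionAlgebra.star_mk, QuaternionAlgebra.mk_mul_mk]; ext <;> norm_num)) 1 0
      (by rw [one_smul, pow_one, pow_zero, mul_one, QuaternionAlgebra.mk_mul_mk]; ext <;> norm_num)
    have hng : ((⟨1, -1, 0, 0⟩ : ℍ[ℚ,((-1 : ℤ) : ℚ),((3 : ℤ) : ℚ)]) * star ⟨1, -1, 0, 0⟩).re = 2 := by
      rw [QuaternionAlgebra.star_mk, QuaternionAlgebra.mk_mul_mk]; norm_num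
    have m : (⟨1, -1, 0, 0⟩ : ℍ[ℚ,((-1 : ℤ) : ℚ),((3 : ℤ) : ℚ)]) * ⟨0, -3, 1, -1⟩ * star ⟨1, -1, 0, 0⟩ = (-2 : ℚ) • (⟨0, 3, 1, 1⟩ : ℍ[ℚ,((-1 : ℤ) : ℚ),((3 : ℤ) : ℚ)]) := by
      rw [QuaternionAlgebra.star_mk, QuaternionAlgebra.mk_mul_mk, QuaternionAlgebra.mk_mul_mk, QuaternionAlgebra.smul_mk]
      ext <;> norm_num
    refine ⟨⟨1, -1, 0, 0⟩ * u, mul_ne_zero₅ hz hu0, normalisesLeft_mul₅ hLu hLg,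
      by rw [re_mul_mul_star_mul, hng, hn]; norm_num, -2, by norm_num, ?_⟩
    rw [star_mul, show (⟨1, -1, 0, 0⟩ : ℍ[ℚ,((-1 : ℤ) : ℚ),((3 : ℤ) : ℚ)]) * u * ⟨0, x.1.1, x.1.2.1, x.1.2.2⟩ * (star u * star ⟨1, -1, 0, 0⟩) =
        ⟨1, -1, 0, 0⟩ * (u * ⟨0, x.1.1, x.1.2.1, x.1.2.2⟩ * star u) * star ⟨1, -1, 0, 0⟩ by simp only [mul_assoc], hconj _ h, m]

/-- **`#(Pt(6)/Γ₆⁺) = 1`: the two SCM points of `X₆` (`Z(6)`: `P₀`, `P₇`) become ONE point of `X₆⁺`** (`w̄₂`, `i`, `w₂`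
carry `3i + ij`, `−3i + j`, `−3i + ij` to `±(3i + j)`). [cite: BayerTravesa2007, §2 Prop. 2.1 and §7 p. 332] [cite: Ogg1983RealPoints, §2 p. 284] -/
theorem card_specialPointsPlus_six :
    Nat.card (Quot (fun p q : {τ : ℂ // 0 < τ.im ∧ ∃ x : ℍ[ℚ,((-1 : ℤ) : ℚ),((3 : ℤ) : ℚ)],
        x ∈ order (-1) 3 ∧ x.re = 0 ∧ (x * star x).re = ((6 : ℤ) : ℚ) ∧ moebius (rho (-1) 3 (by norm_num) (castQ (-1) 3 x)) τ = τ} ↦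
      ∃ g : ℍ[ℚ,((-1 : ℤ) : ℚ),((3 : ℤ) : ℚ)], g ≠ 0 ∧
        (∀ a : ℍ[ℚ,((-1 : ℤ) : ℚ),((3 : ℤ) : ℚ)], (a ∈ order (-1) 3 ∨ a - ⟨1/2, 1/2, 1/2, -1/2⟩ ∈ order (-1) 3) →
          ∃ b : ℍ[ℚ,((-1 : ℤ) : ℚ),((3 : ℤ) : ℚ)], (b ∈ order (-1) 3 ∨ b - ⟨1/2, 1/2, 1/2, -1/2⟩ ∈ order (-1) 3) ∧
            g * a = b * g) ∧
        0 < (g * star g).re ∧ moebius (rho (-1) 3 (by norm_num) (castQ (-1) 3 g)) p.1 = q.1)) = 1 := by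
  refine card_specialPointsPlus_eq_one_of (t := 6) (by norm_num) ⟨(3, 1, 0), by norm_num⟩ fun x ↦ ?_
  obtain ⟨u, hu, hn, hh⟩ := exists_normOne_conj_of_norm_six x.1 x.2
  obtain ⟨hu0, hLu⟩ := normalisesLeft_of_normOne₅ hu hn
  have hu1 : u * star u = 1 := mul_star_eq_one_of_re hn
  have hconj : ∀ c : ℍ[ℚ,((-1 : ℤ) : ℚ),((3 : ℤ) : ℚ)], u * ⟨0, x.1.1, x.1.2.1, x.1.2.2⟩ = c * u → u * ⟨0, x.1.1, x.1.2.1, x.1.2.2⟩ * star u = c :=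
    fun c h ↦ by rw [h, mul_assoc, hu1, mul_one]
  show ∃ g : ℍ[ℚ,((-1 : ℤ) : ℚ),((3 : ℤ) : ℚ)], g ≠ 0 ∧ _ ∧ 0 < (g * star g).re ∧ ∃ s : ℚ, s ≠ 0 ∧
      g * ⟨0, x.1.1, x.1.2.1, x.1.2.2⟩ * star g = s • (⟨0, ((3 : ℤ) : ℚ), ((1 : ℤ) : ℚ), ((0 : ℤ) : ℚ)⟩ : ℍ[ℚ,((-1 : ℤ) : ℚ),((3 : ℤ) : ℚ)])
  rw [show (⟨0, ((3 : ℤ) : ℚ), ((1 : ℤ) : ℚ), ((0 : ℤ) : ℚ)⟩ : ℍ[ℚ,((-1 : ℤ) : ℚ),((3 : ℤ) : ℚ)]) = ⟨0, 3, 1, 0⟩ by ext <;> norm_num]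
  rcases hh with h | h | h | h
  · exact ⟨u, hu0, hLu, by rw [hn]; exact one_pos, 1, one_ne_zero, by rw [hconj _ h, one_smul]⟩
  · -- (3, 0, 1) → 1·c₀ via g = ⟨1, -1, 0, 0⟩ (nr 2) = v·w₂^1·μ^0, v = ⟨0, -1, 0, 0⟩
    have hz : (⟨1, -1, 0, 0⟩ : ℍ[ℚ,((-1 : ℤ) : ℚ),((3 : ℤ) : ℚ)]) ≠ 0 := fun h0 ↦ by
      have := congrArg QuaternionAlgebra.re h0; norm_num at this
    have hLg := normalisesLeft_of_factor₅ (g := (⟨1, -1, 0, 0⟩ : ℍ[ℚ,((-1 : ℤ) : ℚ),((3 : ℤ) : ℚ)])) (v := ⟨0, -1, 0, 0⟩)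
      (Or.inl ⟨![0, -1, 0, 0], by ext <;> simp [ofCoords]⟩)
      (Or.inl (by rw [QuaternionAlgebra.star_mk, QuaternionAlgebra.mk_mul_mk]; ext <;> norm_num)) 1 0
      (by rw [one_smul, pow_one, pow_zero, mul_one, QuaternionAlgebra.mk_mul_mk]; ext <;> norm_num)
    have hng : ((⟨1, -1, 0, 0⟩ : ℍ[ℚ,((-1 : ℤ) : ℚ),((3 : ℤ) : ℚ)]) * star ⟨1, -1, 0, 0⟩).re = 2 := by
      rw [QuaternionAlgebra.star_mk, QuaternionAlgebra.mk_mul_mk]; norm_num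
    have m : (⟨1, -1, 0, 0⟩ : ℍ[ℚ,((-1 : ℤ) : ℚ),((3 : ℤ) : ℚ)]) * ⟨0, 3, 0, 1⟩ * star ⟨1, -1, 0, 0⟩ = (2 : ℚ) • (⟨0, 3, 1, 0⟩ : ℍ[ℚ,((-1 : ℤ) : ℚ),((3 : ℤ) : ℚ)]) := by
      rw [QuaternionAlgebra.star_mk, QuaternionAlgebra.mk_mul_mk, QuaternionAlgebra.mk_mul_mk, QuaternionAlgebra.smul_mk]
      ext <;> norm_num
    refine ⟨⟨1, -1, 0, 0⟩ * u, mul_ne_zero₅ hz hu0, normalisesLeft_mul₅ hLu hLg,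
      by rw [re_mul_mul_star_mul, hng, hn]; norm_num, 2, by norm_num, ?_⟩
    rw [star_mul, show (⟨1, -1, 0, 0⟩ : ℍ[ℚ,((-1 : ℤ) : ℚ),((3 : ℤ) : ℚ)]) * u * ⟨0, x.1.1, x.1.2.1, x.1.2.2⟩ * (star u * star ⟨1, -1, 0, 0⟩) =
        ⟨1, -1, 0, 0⟩ * (u * ⟨0, x.1.1, x.1.2.1, x.1.2.2⟩ * star u) * star ⟨1, -1, 0, 0⟩ by simp only [mul_assoc], hconj _ h, m]
  · -- (-3, 1, 0) → -1·c₀ via g = ⟨0, 1, 0, 0⟩ (nr 1) = v·w₂^0·μ^0, v = ⟨0, 1, 0, 0⟩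
    have hz : (⟨0, 1, 0, 0⟩ : ℍ[ℚ,((-1 : ℤ) : ℚ),((3 : ℤ) : ℚ)]) ≠ 0 := fun h0 ↦ by
      have := congrArg QuaternionAlgebra.imI h0; norm_num at this
    have hLg := normalisesLeft_of_factor₅ (g := (⟨0, 1, 0, 0⟩ : ℍ[ℚ,((-1 : ℤ) : ℚ),((3 : ℤ) : ℚ)])) (v := ⟨0, 1, 0, 0⟩)
      (Or.inl ⟨![0, 1, 0, 0], by ext <;> simp [ofCoords]⟩)
      (Or.inl (by rw [QuaternionAlgebra.star_mk, QuaternionAlgebra.mk_mul_mk]; ext <;> norm_num)) 0 0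
      (by rw [one_smul, pow_zero, pow_zero, mul_one, mul_one])
    have hng : ((⟨0, 1, 0, 0⟩ : ℍ[ℚ,((-1 : ℤ) : ℚ),((3 : ℤ) : ℚ)]) * star ⟨0, 1, 0, 0⟩).re = 1 := by
      rw [QuaternionAlgebra.star_mk, QuaternionAlgebra.mk_mul_mk]; norm_num
    have m : (⟨0, 1, 0, 0⟩ : ℍ[ℚ,((-1 : ℤ) : ℚ),((3 : ℤ) : ℚ)]) * ⟨0, -3, 1, 0⟩ * star ⟨0, 1, 0, 0⟩ = (-1 : ℚ) • (⟨0, 3, 1, 0⟩ : ℍ[ℚ,((-1 : ℤ) : ℚ),((3 : ℤ) : ℚ)]) := by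
      rw [QuaternionAlgebra.star_mk, QuaternionAlgebra.mk_mul_mk, QuaternionAlgebra.mk_mul_mk, QuaternionAlgebra.smul_mk]
      ext <;> norm_num
    refine ⟨⟨0, 1, 0, 0⟩ * u, mul_ne_zero₅ hz hu0, normalisesLeft_mul₅ hLu hLg,
      by rw [re_mul_mul_star_mul, hng, hn]; norm_num, -1, by norm_num, ?_⟩
    rw [star_mul, show (⟨0, 1, 0, 0⟩ : ℍ[ℚ,((-1 : ℤ) : ℚ),((3 : ℤ) : ℚ)]) * u * ⟨0, x.1.1, x.1.2.1, x.1.2.2⟩ * (star u * star ⟨0, 1, 0, 0⟩) =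
        ⟨0, 1, 0, 0⟩ * (u * ⟨0, x.1.1, x.1.2.1, x.1.2.2⟩ * star u) * star ⟨0, 1, 0, 0⟩ by simp only [mul_assoc], hconj _ h, m]
  · -- (-3, 0, 1) → -1·c₀ via g = ⟨1, 1, 0, 0⟩ (nr 2) = v·w₂^1·μ^0, v = ⟨1, 0, 0, 0⟩
    have hz : (⟨1, 1, 0, 0⟩ : ℍ[ℚ,((-1 : ℤ) : ℚ),((3 : ℤ) : ℚ)]) ≠ 0 := fun h0 ↦ by
      have := congrArg QuaternionAlgebra.re h0; norm_num at this
    have hLg := normalisesLeft_of_factor₅ (g := (⟨1, 1, 0, 0⟩ : ℍ[ℚ,((-1 : ℤ) : ℚ),((3 : ℤ) : ℚ)])) (v := ⟨1, 0, 0, 0⟩)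
      (Or.inl ⟨![1, 0, 0, 0], by ext <;> simp [ofCoords]⟩)
      (Or.inl (by rw [QuaternionAlgebra.star_mk, QuaternionAlgebra.mk_mul_mk]; ext <;> norm_num)) 1 0
      (by rw [one_smul, pow_one, pow_zero, mul_one, QuaternionAlgebra.mk_mul_mk]; ext <;> norm_num)
    have hng : ((⟨1, 1, 0, 0⟩ : ℍ[ℚ,((-1 : ℤ) : ℚ),((3 : ℤ) : ℚ)]) * star ⟨1, 1, 0, 0⟩).re = 2 := by
      rw [QuaternionAlgebra.star_mk, QuaternionAlgebra.mk_mul_mk]; norm_num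
    have m : (⟨1, 1, 0, 0⟩ : ℍ[ℚ,((-1 : ℤ) : ℚ),((3 : ℤ) : ℚ)]) * ⟨0, -3, 0, 1⟩ * star ⟨1, 1, 0, 0⟩ = (-2 : ℚ) • (⟨0, 3, 1, 0⟩ : ℍ[ℚ,((-1 : ℤ) : ℚ),((3 : ℤ) : ℚ)]) := by
      rw [QuaternionAlgebra.star_mk, QuaternionAlgebra.mk_mul_mk, QuaternionAlgebra.mk_mul_mk, QuaternionAlgebra.smul_mk]
      ext <;> norm_num
    refine ⟨⟨1, 1, 0, 0⟩ * u, mul_ne_zero₅ hz hu0, normalisesLeft_mul₅ hLu hLg,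
      by rw [re_mul_mul_star_mul, hng, hn]; norm_num, -2, by norm_num, ?_⟩
    rw [star_mul, show (⟨1, 1, 0, 0⟩ : ℍ[ℚ,((-1 : ℤ) : ℚ),((3 : ℤ) : ℚ)]) * u * ⟨0, x.1.1, x.1.2.1, x.1.2.2⟩ * (star u * star ⟨1, 1, 0, 0⟩) =
        ⟨1, 1, 0, 0⟩ * (u * ⟨0, x.1.1, x.1.2.1, x.1.2.2⟩ * star u) * star ⟨1, 1, 0, 0⟩ by simp only [mul_assoc], hconj _ h, m]

/-- **THE `X₆⁺` POINT COUNTS UNDER `Z(1)`, `Z(3)`, `Z(6)`, `Z(19)`: `1, 1, 1, 1`** (`X₆`: `2, 2, 2, 4` points). [cite: BayerTravesa2007, §1 Thm. 1.1 and §2] [cite: KudlaRapoportYang2006, §3.4 Remark 3.4.7] -/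
theorem card_specialPointsPlus_table :
    Nat.card (Quot (fun p q : {τ : ℂ // 0 < τ.im ∧ ∃ x : ℍ[ℚ,((-1 : ℤ) : ℚ),((3 : ℤ) : ℚ)],
        x ∈ order (-1) 3 ∧ x.re = 0 ∧ (x * star x).re = ((1 : ℤ) : ℚ) ∧ moebius (rho (-1) 3 (by norm_num) (castQ (-1) 3 x)) τ = τ} ↦
      ∃ g : ℍ[ℚ,((-1 : ℤ) : ℚ),((3 : ℤ) : ℚ)], g ≠ 0 ∧
        (∀ a : ℍ[ℚ,((-1 : ℤ) : ℚ),((3 : ℤ) : ℚ)], (a ∈ order (-1) 3 ∨ a - ⟨1/2, 1/2, 1/2, -1/2⟩ ∈ order (-1) 3) →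
          ∃ b : ℍ[ℚ,((-1 : ℤ) : ℚ),((3 : ℤ) : ℚ)], (b ∈ order (-1) 3 ∨ b - ⟨1/2, 1/2, 1/2, -1/2⟩ ∈ order (-1) 3) ∧
            g * a = b * g) ∧
        0 < (g * star g).re ∧ moebius (rho (-1) 3 (by norm_num) (castQ (-1) 3 g)) p.1 = q.1)) = 1 ∧
    Nat.card (Quot (fun p q : {τ : ℂ // 0 < τ.im ∧ ∃ x : ℍ[ℚ,((-1 : ℤ) : ℚ),((3 : ℤ) : ℚ)],
        x ∈ order (-1) 3 ∧ x.re = 0 ∧ (x * star x).re = ((3 : ℤ) : ℚ) ∧ moebius (rho (-1) 3 (by norm_num) (castQ (-1) 3 x)) τ = τ} ↦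
      ∃ g : ℍ[ℚ,((-1 : ℤ) : ℚ),((3 : ℤ) : ℚ)], g ≠ 0 ∧
        (∀ a : ℍ[ℚ,((-1 : ℤ) : ℚ),((3 : ℤ) : ℚ)], (a ∈ order (-1) 3 ∨ a - ⟨1/2, 1/2, 1/2, -1/2⟩ ∈ order (-1) 3) →
          ∃ b : ℍ[ℚ,((-1 : ℤ) : ℚ),((3 : ℤ) : ℚ)], (b ∈ order (-1) 3 ∨ b - ⟨1/2, 1/2, 1/2, -1/2⟩ ∈ order (-1) 3) ∧
            g * a = b * g) ∧
        0 < (g * star g).re ∧ moebius (rho (-1) 3 (by norm_num) (castQ (-1) 3 g)) p.1 = q.1)) = 1 ∧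
    Nat.card (Quot (fun p q : {τ : ℂ // 0 < τ.im ∧ ∃ x : ℍ[ℚ,((-1 : ℤ) : ℚ),((3 : ℤ) : ℚ)],
        x ∈ order (-1) 3 ∧ x.re = 0 ∧ (x * star x).re = ((6 : ℤ) : ℚ) ∧ moebius (rho (-1) 3 (by norm_num) (castQ (-1) 3 x)) τ = τ} ↦
      ∃ g : ℍ[ℚ,((-1 : ℤ) : ℚ),((3 : ℤ) : ℚ)], g ≠ 0 ∧
        (∀ a : ℍ[ℚ,((-1 : ℤ) : ℚ),((3 : ℤ) : ℚ)], (a ∈ order (-1) 3 ∨ a - ⟨1/2, 1/2, 1/2, -1/2⟩ ∈ order (-1) 3) →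
          ∃ b : ℍ[ℚ,((-1 : ℤ) : ℚ),((3 : ℤ) : ℚ)], (b ∈ order (-1) 3 ∨ b - ⟨1/2, 1/2, 1/2, -1/2⟩ ∈ order (-1) 3) ∧
            g * a = b * g) ∧
        0 < (g * star g).re ∧ moebius (rho (-1) 3 (by norm_num) (castQ (-1) 3 g)) p.1 = q.1)) = 1 ∧
    Nat.card (Quot (fun p q : {τ : ℂ // 0 < τ.im ∧ ∃ x : ℍ[ℚ,((-1 : ℤ) : ℚ),((3 : ℤ) : ℚ)],
        x ∈ order (-1) 3 ∧ x.re = 0 ∧ (x * star x).re = ((19 : ℤ) : ℚ) ∧ moebius (rho (-1) 3 (by norm_num) (castQ (-1) 3 x)) τ = τ} ↦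
      ∃ g : ℍ[ℚ,((-1 : ℤ) : ℚ),((3 : ℤ) : ℚ)], g ≠ 0 ∧
        (∀ a : ℍ[ℚ,((-1 : ℤ) : ℚ),((3 : ℤ) : ℚ)], (a ∈ order (-1) 3 ∨ a - ⟨1/2, 1/2, 1/2, -1/2⟩ ∈ order (-1) 3) →
          ∃ b : ℍ[ℚ,((-1 : ℤ) : ℚ),((3 : ℤ) : ℚ)], (b ∈ order (-1) 3 ∨ b - ⟨1/2, 1/2, 1/2, -1/2⟩ ∈ order (-1) 3) ∧
            g * a = b * g) ∧
        0 < (g * star g).re ∧ moebius (rho (-1) 3 (by norm_num) (castQ (-1) 3 g)) p.1 = q.1)) = 1 :=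
  ⟨card_specialPointsPlus_one, card_specialPointsPlus_three, card_specialPointsPlus_six, card_specialPointsPlus_nineteen⟩

end Small

end Literature.Geometry.Kaehler.ComplexTorus.QuaternionType
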